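import Mathlib
import HarnessLib
import Summits.PneNP.PneNP.Theorems.AeaCutRectanglesDutyRectangles

/-!
# Route AeaCutRectangles — crux `FoolingMeasure` (stmt-PneNP-19727): TRANSPORT AND RELABELLING OF DUTY RECTANGLES

Bookkeeping for the duty form of X1 (`AeaCutRectanglesDutyRectangles.foolingMeasure_iff_duty`):

* `dutyMap σ Φ` — the duty `Φ ⊆ (V → Fin 3)` transported along a bijection `σ : V ≃ W`
  (`d ∈ dutyMap σ Φ ↔ d ∘ σ ∈ Φ`); `relabel σ G` — the relabelled edge set;
* `relabel_mem_dutyRect` / `dutyFinset_relabel` — relabelling maps the duty rectangle of `(B, Φ)` onto the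
  duty rectangle of `(σ B, dutyMap σ Φ)`; `dutySum_relabel` — hence duty masses transport;
* `dutySum_eq_of_invariant` — for a relabelling-INVARIANT measure on `Fin n` the duty mass depends on the cut
  only through the relabelling class (so only `|B|` matters: X1 is a statement about ONE cut per size for
  symmetrised measures — the normal form used by the line `Cruxes/FoolingMeasure/Lines/duty.lean`);
* `dutyFooling_transport` — a duty-fooling measure on ANY finite vertex type `V` with `V ≃ Fin n` yields one on
  `Fin n` with the same bound at every cut of the same sizes (constructions may live on structured vertex
  types, as the Toft system of the fixed-cut rung does on `Fin 10 × Fin L`).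

HONEST FRAMING: elementary transport lemmas; FRONTIER material for a rung of Fagin's complement ladder; nothing
here bears on P vs NP.
-/

set_option linter.dupNamespace false -- `Summit.PneNP.PneNP.…`: summit = sub-problem name (D-0017 single-conjunct layout)

namespace Summit.PneNP.PneNP.Theorems.AeaCutRectanglesDutyTransport

open Finset
open Summit.PneNP.PneNP.Theorems.AeaCutRectanglesDutyRectangles

variable {V W : Type*}

/-! ### Transport of duties and edge sets along a bijection -/

/-- The duty `Φ` transported along `σ : V ≃ W`: a colouring `d` of `W` is on duty iff `d ∘ σ` is. -/
def dutyMap (σ : V ≃ W) (Φ : Set (V → Fin 3)) : Set (W → Fin 3) :=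
  {d | d ∘ σ ∈ Φ}

/-- Unfolding `dutyMap`. -/
theorem mem_dutyMap {σ : V ≃ W} {Φ : Set (V → Fin 3)} {d : W → Fin 3} :
    d ∈ dutyMap σ Φ ↔ d ∘ σ ∈ Φ := Iff.rfl

/-- Transport back and forth is the identity. -/
theorem dutyMap_symm_dutyMap (σ : V ≃ W) (Φ : Set (V → Fin 3)) :
    dutyMap σ.symm (dutyMap σ Φ) = Φ := by
  ext c
  simp only [mem_dutyMap, Function.comp_assoc, Equiv.symm_comp_self, Function.comp_id]

/-- Transport forth and back is the identity. -/
theorem dutyMap_dutyMap_symm (σ : V ≃ W) (Ψ : Set (W → Fin 3)) :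
    dutyMap σ (dutyMap σ.symm Ψ) = Ψ := by
  simpa using dutyMap_symm_dutyMap σ.symm Ψ

variable [DecidableEq V] [DecidableEq W]

/-- The relabelled edge set. -/
def relabel (σ : V ≃ W) (G : Finset (Sym2 V)) : Finset (Sym2 W) :=
  G.image (Sym2.map σ)

omit [DecidableEq V] in
/-- Membership in a relabelled edge set. -/
theorem mem_relabel {σ : V ≃ W} {G : Finset (Sym2 V)} {e : Sym2 W} :
    e ∈ relabel σ G ↔ ∃ e' ∈ G, Sym2.map σ e' = e := mem_image

/-- Relabelling back and forth is the identity. -/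
theorem relabel_symm_relabel (σ : V ≃ W) (G : Finset (Sym2 V)) : relabel σ.symm (relabel σ G) = G := by
  simp only [relabel, Finset.image_image]
  have h : (Sym2.map σ.symm ∘ Sym2.map σ : Sym2 V → Sym2 V) = id := by
    funext e
    rw [Function.comp_apply, Sym2.map_map, Equiv.symm_comp_self, Sym2.map_id]
  rw [h, Finset.image_id]

/-- Relabelling forth and back is the identity. -/
theorem relabel_relabel_symm (σ : V ≃ W) (G : Finset (Sym2 W)) : relabel σ (relabel σ.symm G) = G := by
  simpa using relabel_symm_relabel σ.symm G

/-- Relabelling is injective. -/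
theorem relabel_injective (σ : V ≃ W) : Function.Injective (relabel σ) :=
  Function.LeftInverse.injective (relabel_symm_relabel σ)

omit [DecidableEq V] in
/-- Relabelling preserves looplessness. -/
theorem relabel_loopless {σ : V ≃ W} {G : Finset (Sym2 V)} (hG : ∀ e ∈ G, ¬ e.IsDiag) :
    ∀ e ∈ relabel σ G, ¬ e.IsDiag := by
  intro e he
  obtain ⟨e', he', rfl⟩ := mem_relabel.1 he
  rw [Sym2.isDiag_map σ.injective]
  exact hG e' he'

omit [DecidableEq V] in
/-- Relabelling preserves (non-)3-colourability of the graph of an edge set. -/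
theorem colorable_relabel_iff (σ : V ≃ W) (G : Finset (Sym2 V)) :
    (SimpleGraph.fromEdgeSet (↑(relabel σ G) : Set (Sym2 W))).Colorable 3 ↔
      (SimpleGraph.fromEdgeSet (↑G : Set (Sym2 V))).Colorable 3 := by
  rw [colorable_iff_exists_not_mem_killSet, colorable_iff_exists_not_mem_killSet]
  constructor
  · rintro ⟨d, hd⟩
    refine ⟨d ∘ σ, fun ⟨e, he, hdiag, hm⟩ => hd ⟨Sym2.map σ e, mem_image_of_mem _ he, ?_, ?_⟩⟩
    · rwa [Sym2.isDiag_map σ.injective]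
    · rwa [Sym2.map_map]
  · rintro ⟨c, hc⟩
    refine ⟨c ∘ σ.symm, fun ⟨e, he, hdiag, hm⟩ => ?_⟩
    obtain ⟨e', he', rfl⟩ := mem_relabel.1 he
    refine hc ⟨e', he', ?_, ?_⟩
    · rwa [Sym2.isDiag_map σ.injective] at hdiag
    · rw [Sym2.map_map] at hm
      have h : ((c ∘ σ.symm) ∘ σ : V → Fin 3) = c := by
        funext v
        simp
      rwa [h] at hm

/-! ### Relabelling maps duty rectangles onto duty rectangles -/

omit [DecidableEq V] in
/-- **Core transport lemma**: relabelling a member of the duty rectangle of `(B, Φ)` gives a member of the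
duty rectangle of `(σ B, dutyMap σ Φ)`. -/
theorem relabel_mem_dutyRect [DecidableEq V] {σ : V ≃ W} {B : Finset V} {Φ : Set (V → Fin 3)}
    {G : Finset (Sym2 V)} (hG : G ∈ dutyRect B Φ) :
    relabel σ G ∈ dutyRect (B.image σ) (dutyMap σ Φ) := by
  refine ⟨relabel_loopless hG.1, fun d hd => ?_, fun d hd => ?_⟩
  · obtain ⟨e, he, hin, hm⟩ := hG.2.1 (d ∘ σ) hd
    refine ⟨Sym2.map σ e, mem_image_of_mem _ he, fun w hw => ?_, by rwa [Sym2.map_map]⟩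
    obtain ⟨v, hv, rfl⟩ := Sym2.mem_map.1 hw
    exact mem_image_of_mem _ (hin v hv)
  · have hd' : d ∘ σ ∉ Φ := hd
    obtain ⟨e, he, ⟨v, hv, hvB⟩, hm⟩ := hG.2.2 (d ∘ σ) hd'
    refine ⟨Sym2.map σ e, mem_image_of_mem _ he, ⟨σ v, Sym2.mem_map.2 ⟨v, hv, rfl⟩, fun h => ?_⟩,
      by rwa [Sym2.map_map]⟩
    obtain ⟨v', hv', hvv'⟩ := mem_image.1 h
    exact hvB (σ.injective hvv' ▸ hv')

variable [Fintype V] [Fintype W]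

/-- Relabelling maps the duty rectangle of `(B, Φ)` ONTO that of `(σ B, dutyMap σ Φ)`. -/
theorem dutyFinset_relabel (σ : V ≃ W) (B : Finset V) (Φ : Set (V → Fin 3)) :
    dutyFinset (B.image σ) (dutyMap σ Φ) = (dutyFinset B Φ).image (relabel σ) := by
  ext G'
  rw [mem_dutyFinset, mem_image]
  constructor
  · intro h
    refine ⟨relabel σ.symm G', mem_dutyFinset.2 ?_, relabel_relabel_symm σ G'⟩
    have h' := relabel_mem_dutyRect (σ := σ.symm) h
    rwa [Finset.image_image, Equiv.symm_comp_self, Finset.image_id, dutyMap_symm_dutyMap] at h'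
  · rintro ⟨G, hG, rfl⟩
    exact relabel_mem_dutyRect (mem_dutyFinset.1 hG)

/-- **Duty masses transport**: the `μ`-mass of the duty rectangle of `(σ B, dutyMap σ Φ)` is the
`μ ∘ relabel σ`-mass of the duty rectangle of `(B, Φ)`. -/
theorem dutySum_relabel (σ : V ≃ W) (μ : Finset (Sym2 W) → ℝ) (B : Finset V) (Φ : Set (V → Fin 3)) :
    ∑ G' ∈ dutyFinset (B.image σ) (dutyMap σ Φ), μ G' = ∑ G ∈ dutyFinset B Φ, μ (relabel σ G) := by
  rw [dutyFinset_relabel, sum_image fun G _ G' _ h => relabel_injective σ h]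

/-- **Invariant measures see only the relabelling class of a cut**: if `μ` on `Fin n` is invariant under all
relabellings, the duty mass of `(σ B, dutyMap σ Φ)` equals that of `(B, Φ)`.  (So for a symmetrised measure
X1's clause needs checking at ONE cut of each size in the window.) -/
theorem dutySum_eq_of_invariant {n : ℕ} (μ : Finset (Sym2 (Fin n)) → ℝ)
    (hμ : ∀ σ : Equiv.Perm (Fin n), ∀ G, μ (relabel σ G) = μ G) (σ : Equiv.Perm (Fin n))
    (B : Finset (Fin n)) (Φ : Set (Fin n → Fin 3)) :
    ∑ G ∈ dutyFinset (B.image σ) (dutyMap σ Φ), μ G = ∑ G ∈ dutyFinset B Φ, μ G := by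
  rw [dutySum_relabel]
  exact sum_congr rfl fun G _ => hμ σ G

/-! ### Transport of a duty-fooling measure to `Fin n` -/

/-- **TRANSPORT.**  A measure on the edge sets of a finite vertex type `V` which is non-negative, has total mass
`1`, is supported on loopless non-3-colourable edge sets, and gives every duty rectangle over every cut `B` with
`P |B|` mass `≤ δ`, yields — along any bijection `σ : V ≃ W` — a measure on `W` with the same four properties
(cuts `B'` with `P |B'|`).  Used with `W = Fin n`. -/
theorem dutyFooling_transport (σ : V ≃ W) (P : ℕ → Prop) (δ : ℝ) (μ : Finset (Sym2 V) → ℝ)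
    (h0 : ∀ S, 0 ≤ μ S) (h1 : ∑ S, μ S = 1)
    (hs : ∀ S, μ S ≠ 0 → (∀ e ∈ S, ¬ e.IsDiag) ∧
      ¬ (SimpleGraph.fromEdgeSet (S : Set (Sym2 V))).Colorable 3)
    (hd : ∀ B : Finset V, P B.card → ∀ Φ : Set (V → Fin 3), ∑ G ∈ dutyFinset B Φ, μ G ≤ δ) :
    ∃ μ' : Finset (Sym2 W) → ℝ, (∀ S, 0 ≤ μ' S) ∧ (∑ S, μ' S = 1) ∧
      (∀ S, μ' S ≠ 0 → (∀ e ∈ S, ¬ e.IsDiag) ∧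
        ¬ (SimpleGraph.fromEdgeSet (S : Set (Sym2 W))).Colorable 3) ∧
      ∀ B' : Finset W, P B'.card → ∀ Ψ : Set (W → Fin 3), ∑ G ∈ dutyFinset B' Ψ, μ' G ≤ δ := by
  refine ⟨fun S => μ (relabel σ.symm S), fun S => h0 _, ?_, fun S hS => ?_, fun B' hB' Ψ => ?_⟩
  · -- total mass: `relabel σ.symm` is a bijection of edge sets
    rw [← h1]
    exact Finset.sum_bijective (relabel σ.symm)
      ⟨relabel_injective σ.symm, fun G => ⟨relabel σ G, relabel_symm_relabel σ G⟩⟩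
      (fun _ => by simp) (fun _ _ => rfl)
  · obtain ⟨hl, hc⟩ := hs _ hS
    refine ⟨fun e he => ?_, ?_⟩
    · have h := relabel_loopless (σ := σ) hl
      rw [relabel_relabel_symm] at h
      exact h e he
    · rwa [colorable_relabel_iff] at hc
  · -- the cut `B'` and duty `Ψ` are the transports of `B := σ⁻¹ B'`, `Φ := dutyMap σ⁻¹ Ψ`
    have hB : (B'.image σ.symm).card = B'.card := card_image_of_injective _ σ.symm.injective
    have key := dutySum_relabel σ (fun S => μ (relabel σ.symm S)) (B'.image σ.symm) (dutyMap σ.symm Ψ)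
    rw [Finset.image_image, Equiv.self_comp_symm, Finset.image_id, dutyMap_dutyMap_symm] at key
    rw [key]
    simp only [relabel_symm_relabel]
    exact hd _ (hB ▸ hB') _

end Summit.PneNP.PneNP.Theorems.AeaCutRectanglesDutyTransport
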